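import Summits.QuantumFields.YangMills.Theses.FemtoCutoffLadder
import Summits.QuantumFields.YangMills.Theorems.FemtoCutoffLadderUpperTowerTelescoping
import Summits.QuantumFields.YangMills.Theorems.FemtoCutoffLadderMatchedCouplingExists

/-!
# Route `FemtoCutoffLadder` — `DyadicNestedUpper` (stmt-QuantumFields-25766) BY NAME from one-octave upper steps with decay

Lead seat `ym-line-fcl-p1` g9 (2026-08-28).  By-name closer of the route-independent telescoping
`CutoffLadder.dyadicNestedUpper_text_of_octaveUpper` (`Theorems/FemtoCutoffLadderUpperTowerTelescoping.lean`): the ONE-OCTAVE UPPER step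
«fine below coarse» with a summable Symanzik-type defect and the telescoping asymptotic-scaling allowance, for every base `L' ≥ L₀`,

  `OctaveUpperDecay` (spelled out as the hypothesis): `∃ C σ D lam₀ L₀, σ > 0, lam₀ > 0, D ≥ 0`, and for matched window couplings
  `(β, 2L')`, `(β', L')`, `L' ≥ L₀`:  `λ₁(L')^{L'}·λ₀(2L')^{2L'} ≤ exp(CΛ²/L'^σ + D(1/β' − 1/β))·λ₁(2L')^{2L'}·λ₀(L')^{L'}`,

implies the route child `DyadicNestedUpper` (all heights `k`, uniformly) with `C_DNU = max(C,0)/(1 − 2^{−σ}) + D`; matching from the proved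
support `matchedCouplingExists_proof`.  This is the exact mirror image, in the VARIATIONAL direction, of how `OctaveStepDecay` (24153) is
consumed by the proved `Assembly2`: a prover of 25766 may therefore work one octave at a time (one pulled-back trial function through the
factor-2 block map / the ratio-2 thinning, `BlockPullback.*`, `Dirichlet.fine_gap_le_dirichlet_of_pullback`, `thin`) with precision
`CΛ²/L'^σ` per octave, instead of a `k`-uniform `2^k`-fold pull-back.
HONEST FRAMING: bookkeeping; the octave upper step is OPEN (two-cutoff, behind `UVStabilityNonUniqueness`).  R2b1 is a RECORD rung — not
infinite volume, not a mass gap, not Clay; no summit is proved by this line.  No definitions, no named facts, no `sorry`.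
-/

set_option autoImplicit false

noncomputable section

namespace Summit.QuantumFields.YangMills.Theorems.FemtoCutoffLadder

open Summit.QuantumFields.YangMills.Theorems.FemtoTransferGap
open Summit.QuantumFields.YangMills.Theses.FemtoCutoffLadder

/-- ★★ **`DyadicNestedUpper` from one-octave upper steps with decay.**  The one-octave upper step «fine below coarse» for every base
`L' ≥ L₀`, with summable defect `CΛ²/L'^σ` (`σ > 0`) and telescoping allowance `D(1/β' − 1/β)` (`D ≥ 0`), implies the route child
`DyadicNestedUpper` (stmt-QuantumFields-25766) BY NAME. [cite: LuscherWeiszWolff1991] [cite: Symanzik1983] -/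
theorem dyadicNestedUpper_of_octaveUpperDecay
    (hU : ∃ (C σ D lam0 : ℝ) (L0 : ℕ), 0 < σ ∧ 0 < lam0 ∧ 0 ≤ D ∧ ∀ lam : ℝ, 0 < lam → lam ≤ lam0 →
      ∀ (L' : ℕ) [NeZero L'] (L : ℕ) [NeZero L], L0 ≤ L' → L = 2 * L' →
        ∀ β β' : ℝ, InFemtoWindow lam β L → InFemtoWindow lam β' L' → luscherLambda β L = luscherLambda β' L' →
          secondValue su2Rep L' β' ^ L' * topValue su2Rep L β ^ L ≤
            Real.exp (C * luscherLambda β L ^ 2 / (L' : ℝ) ^ σ + D * (1 / β' - 1 / β)) *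
              (secondValue su2Rep L β ^ L * topValue su2Rep L' β' ^ L')) :
    DyadicNestedUpper := by
  obtain ⟨C, σ, D, lam0, L0, hσ, hlam0, hD, HU⟩ := hU
  obtain ⟨C₁, lam₁, hlam₁, H⟩ :=
    CutoffLadder.dyadicNestedUpper_text_of_octaveUpper hσ hlam0 hD HU matchedCouplingExists_proof
  exact ⟨C₁, lam₁, L0, hlam₁, fun lam hlam hle k L' _ L _ hL0 hL β β' hW hW' hm =>
    H lam hlam hle k L' L hL0 hL β β' hW hW' hm⟩

end Summit.QuantumFields.YangMills.Theorems.FemtoCutoffLadder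

end
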